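import Mathlib
import HarnessLib
import Summits.ValiantsHypothesis.ValiantsHypothesis.Theorems.LacunarySymmetroidMatrixDescartesProductPlusOneKernelConvexShell
import Summits.ValiantsHypothesis.ValiantsHypothesis.Theorems.LacunarySymmetroidMatrixDescartesProductPlusOneSlowKneeCloudKernel
import Summits.ValiantsHypothesis.ValiantsHypothesis.Theorems.LacunarySymmetroidMatrixDescartesProductPlusOneCloudConvexity
import Summits.ValiantsHypothesis.ValiantsHypothesis.Theorems.LacunarySymmetroidMatrixDescartesProductPlusOneSlopeLine

/-!
# LINE (A) `product_plus_one` (crux `MatrixDescartes`, stmt-ValiantsHypothesis-18050, V1) — W-CB, ★★ the SLOW-KNEE CLOUD CELL (E4):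
# `W(∏ f_j)` has AT MOST TWO roots in `(u,v)` when every row is a slow knee, a switched binomial puller, or an unswitched incoherent cloud row

Owner memo `pub/ideators/val-idea-25/NOTE-idea25g3-18050-LINEA-AB-reduction.md` §19.1 (val-idea-25 g4; typed scratch `staged/scratch19-slowknee-cloud-cell.lean`,
decl `SlowKneeCloudCellK3`; 2 950 exact companies, 0 violations).  `K = 3`, support `d 0 < d 1 < d 2` with the GAP CONDITION `d 1 − d 0 ≤ d 2 − d 1`
(`e₁ ≤ e₂`); rows `f_j = Σ_l C (a j l) X^{d l}` of three kinds — SLOW KNEE (`a_{j0}, a_{j1} > 0`, `a_{j2} = 0`), SWITCHED BINOMIAL PULLER (`a_{j0} > 0 > a_{j1}`,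
`a_{j2} = 0`, `f_j(u) ≤ 0`), UNSWITCHED INCOHERENT CLOUD ROW (`a_{j0} > 0`, `a_{j1}, a_{j2} ≤ 0`, `a_{j1} + a_{j2} < 0`, `f_j(v) > 0`) — at least one switched
puller, `0 < u`.  Then the log-Wronskian `W(P) = P·θ(θP) − (θP)²` of `P = ∏_j f_j` has at most two roots in `(u, v)`: the first W-cell with UNBOUNDEDLY MANY
features (knees, left poles, cloud rows) in one window — W-CB's «slow knees never separate, the cloud never separates» (`K^> = 0` half of the rate rule).

Proof (the pen's route, p5's engine): off the poles `W(P)(x) = −P(x)²·Σ_j ψ₁^{(j)}(x)` (✓ `logWronskian_prod_eq_rowPsi1_sum`); with `y = x^p` (`p = e₁+1`) the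
binomial rows give `ψ₁^{(j)} = p²·ρ_j·y/(y−ρ_j)²` (✓ `rowPsi1_binomial_eq`; knees `ρ_j < 0`, switched pullers `0 < ρ_j ≤ u^p`) and the cloud rows give
`p²·y·G_j(y)`, `G_j(y) = ψ₁^{(j)}(y^{1/p})/(p²y)` non-decreasing and with non-decreasing derivative on `(u^p, v^p)` (✓ `hasDerivAt_cloudSum`,
✓ `cloudSum_deriv_nonneg`, ✓ `cloudSum_deriv_monotoneOn`, fed by (E2) ✓ `rowPsi2_ge` / ✓ `rowPsi3_convex` of val-lit-p8 g16's `…CloudConvexity`); three roots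
of `W(P)` in `(u,v)` would be three zeros of `Σ_{kernel} ρ_j/(y−ρ_j)² + Σ_{cloud} G_j(y)` in `(u^p, v^p)`, excluded by (E1) ✓ `kernelPlusConvex_inner_no_three_zeros`.

* `slowKneeCloud_wronskian_no_three_zeros` — the three-point form;  ★★ `slowKneeCloud_wronskian_roots_le_two` — the count (the pen's `SlowKneeCloudCellK3`, with
  `fewnomial` / `thetaW` spelled out).

Honest framing: ONE W-cell of the research floor (the `K^> = 0` half of the rate rule); the fast-knee half, `WronskianBudgetK3` (def #20), `OneChangeFloorK3`,
`stub_classRowK3`, `stub_polyLaw`, `MatrixDescartes`, Conjecture B are NOT proved; `VP ≠ VNP` NOT proved.  No definitions, no named facts.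
-/

set_option linter.dupNamespace false

namespace Summit.ValiantsHypothesis.ValiantsHypothesis.Theorems.LacunarySymmetroidMatrixDescartes

namespace ProductPlusOne

open Finset Set Polynomial
open scoped BigOperators Topology Polynomial

/-- ★★ **THE SLOW-KNEE CLOUD CELL, three-point form.**  Support `d 0 < d 1 < d 2` with `d 1 − d 0 ≤ d 2 − d 1`; every row a slow knee
(`0 < a_{j0}`, `0 < a_{j1}`, `a_{j2} = 0`), a switched binomial puller (`0 < a_{j0}`, `a_{j1} < 0`, `a_{j2} = 0`, `f_j(u) ≤ 0`) or an unswitched incoherent cloud row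
(`0 < a_{j0}`, `a_{j1} ≤ 0`, `a_{j2} ≤ 0`, `a_{j1} + a_{j2} < 0`, `0 < f_j(v)`), with at least one switched puller, `0 < u`.  Then `W(∏_j f_j)` does not vanish at three
points `x₁ < x₂ < x₃` of `(u, v)`. [this file's theorem] -/
theorem slowKneeCloud_wronskian_no_three_zeros {m : ℕ} (d : Fin 3 → ℕ) (h01 : d 0 < d 1) (h12 : d 1 < d 2) (hgap : d 1 - d 0 ≤ d 2 - d 1)
    (a : Fin m → Fin 3 → ℝ) {u v : ℝ} (hu : 0 < u)
    (hrow : ∀ j, (0 < a j 0 ∧ 0 < a j 1 ∧ a j 2 = 0) ∨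
      (0 < a j 0 ∧ a j 1 < 0 ∧ a j 2 = 0 ∧ (∑ l, C (a j l) * X ^ (d l) : ℝ[X]).eval u ≤ 0) ∨
      (0 < a j 0 ∧ a j 1 ≤ 0 ∧ a j 2 ≤ 0 ∧ a j 1 + a j 2 < 0 ∧ 0 < (∑ l, C (a j l) * X ^ (d l) : ℝ[X]).eval v))
    (hex : ∃ j, a j 1 < 0 ∧ a j 2 = 0 ∧ (∑ l, C (a j l) * X ^ (d l) : ℝ[X]).eval u ≤ 0)
    {x₁ x₂ x₃ : ℝ} (h₁ : x₁ ∈ Ioo u v) (h₃ : x₃ ∈ Ioo u v) (h12' : x₁ < x₂) (h23 : x₂ < x₃)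
    (hzero : ∀ x ∈ ({x₁, x₂, x₃} : Set ℝ),
      ((∏ j, ∑ l, C (a j l) * X ^ (d l) : ℝ[X]) * (X * derivative (X * derivative (∏ j, ∑ l, C (a j l) * X ^ (d l) : ℝ[X])))
        - (X * derivative (∏ j, ∑ l, C (a j l) * X ^ (d l) : ℝ[X])) ^ 2).eval x = 0) : False := by
  classical
  obtain ⟨e₁, he₁⟩ := Nat.exists_eq_add_of_lt h01
  obtain ⟨e₂, he₂⟩ := Nat.exists_eq_add_of_lt h12
  have he : e₁ ≤ e₂ := by omega
  have hd := fin3_support_eq_gaps d e₁ e₂ he₁ he₂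
  have hev : ∀ j x, (∑ l, C (a j l) * X ^ (d l) : ℝ[X]).eval x
      = x ^ (d 0) * (a j 0 + a j 1 * x ^ (e₁ + 1) + a j 2 * x ^ (e₁ + e₂ + 2)) := by
    intro j x
    have h := (eval_trinomial_three (d 0) (e₁ + 1) (e₁ + e₂ + 2) (a j) x).1
    rw [hd] at h; rw [h]; ring
  have huv : u < v := h₁.1.trans h₁.2
  have h₂ : x₂ ∈ Ioo u v := ⟨h₁.1.trans h12', h23.trans h₃.2⟩
  have hIoo : ∀ x ∈ ({x₁, x₂, x₃} : Set ℝ), x ∈ Ioo u v := by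
    intro x hx
    simp only [Set.mem_insert_iff, Set.mem_singleton_iff] at hx
    rcases hx with h | h | h <;> subst h <;> assumption
  -- the stripped rows `g_j(x) = a_{j0} + a_{j1}x^p + a_{j2}x^q`
  -- CLOUD rows (predicate `Pc`): unswitched on `(u, v)`
  set Pc : Fin m → Prop := fun j => 0 < a j 0 ∧ a j 1 ≤ 0 ∧ a j 2 ≤ 0 ∧ a j 1 + a j 2 < 0 ∧
    0 < (∑ l, C (a j l) * X ^ (d l) : ℝ[X]).eval v with hPc
  have hcloud : ∀ j, Pc j → ∀ x ∈ Ioo u v, 0 < a j 0 - (-(a j 1)) * x ^ (e₁ + 1) - (-(a j 2)) * x ^ (e₁ + e₂ + 2) := by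
    intro j hj x hx
    obtain ⟨_, h1, h2, _, hv⟩ := hj
    rw [hev] at hv
    have hv0 : 0 < v := hu.trans huv
    have hx0 : 0 < x := hu.trans hx.1
    have h3 : 0 < a j 0 + a j 1 * v ^ (e₁ + 1) + a j 2 * v ^ (e₁ + e₂ + 2) := (mul_pos_iff_of_pos_left (pow_pos hv0 _)).1 hv
    have hm1 : a j 1 * v ^ (e₁ + 1) ≤ a j 1 * x ^ (e₁ + 1) :=
      mul_le_mul_of_nonpos_left (pow_le_pow_left₀ hx0.le hx.2.le _) h1
    have hm2 : a j 2 * v ^ (e₁ + e₂ + 2) ≤ a j 2 * x ^ (e₁ + e₂ + 2) :=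
      mul_le_mul_of_nonpos_left (pow_le_pow_left₀ hx0.le hx.2.le _) h2
    linarith
  -- KERNEL rows (`¬ Pc`): knees or switched pullers; root `ρ_j = a_{j0}/(−a_{j1})` in `y = x^p`
  have hker : ∀ j, ¬ Pc j → a j 2 = 0 ∧ a j 1 ≠ 0 ∧ 0 < a j 0 ∧ a j 0 / (-(a j 1)) ≤ u ^ (e₁ + 1) ∧
      (∀ x ∈ Ioo u v, a j 0 - (-(a j 1)) * x ^ (e₁ + 1) ≠ 0) := by
    intro j hj
    rcases hrow j with ⟨h0, h1, h2⟩ | ⟨h0, h1, h2, hsw⟩ | h3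
    · -- slow knee: `ρ < 0`
      refine ⟨h2, h1.ne', h0, ?_, fun x hx => ?_⟩
      · have : a j 0 / (-(a j 1)) < 0 := div_neg_of_pos_of_neg h0 (by linarith)
        linarith [pow_pos hu (e₁ + 1)]
      · have hx0 : 0 < x := hu.trans hx.1
        have : 0 < a j 0 - (-(a j 1)) * x ^ (e₁ + 1) := by nlinarith [pow_pos hx0 (e₁ + 1)]
        exact this.ne'
    · -- switched puller: `0 < ρ ≤ u^p`
      rw [hev, h2] at hsw
      have hsw' : a j 0 + a j 1 * u ^ (e₁ + 1) ≤ 0 := by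
        have h := hsw
        simp only [zero_mul, add_zero] at h
        rcases (mul_nonpos_iff.1 h) with ⟨_, hle⟩ | ⟨hlt, _⟩
        · exact hle
        · exact absurd (pow_pos hu (d 0)) (not_lt.2 hlt)
      refine ⟨h2, h1.ne, h0, ?_, fun x hx => ?_⟩
      · rw [div_le_iff₀ (by linarith)]
        linarith
      · have hx0 : 0 < x := hu.trans hx.1
        have hlt : a j 1 * x ^ (e₁ + 1) < a j 1 * u ^ (e₁ + 1) :=
          mul_lt_mul_of_neg_left (pow_lt_pow_left₀ hx.1 hu.le (Nat.succ_ne_zero e₁)) h1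
        have : a j 0 - (-(a j 1)) * x ^ (e₁ + 1) < 0 := by linarith
        exact this.ne
    · exact absurd h3 hj
  -- no row vanishes on the window
  have hg : ∀ x ∈ Ioo u v, ∀ j, a j 0 - (-(a j 1)) * x ^ (e₁ + 1) - (-(a j 2)) * x ^ (e₁ + e₂ + 2) ≠ 0 := by
    intro x hx j
    by_cases hj : Pc j
    · exact (hcloud j hj x hx).ne'
    · obtain ⟨h2, -, -, -, hne⟩ := hker j hj
      rw [h2, neg_zero, zero_mul, sub_zero]
      exact hne x hx
  have hf : ∀ x ∈ Ioo u v, ∀ j, (∑ l, C (a j l) * X ^ (d l) : ℝ[X]).eval x ≠ 0 := by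
    intro x hx j
    have hx0 : 0 < x := hu.trans hx.1
    rw [hev]
    have : a j 0 + a j 1 * x ^ (e₁ + 1) + a j 2 * x ^ (e₁ + e₂ + 2)
        = a j 0 - (-(a j 1)) * x ^ (e₁ + 1) - (-(a j 2)) * x ^ (e₁ + e₂ + 2) := by ring
    rw [this]
    exact mul_ne_zero (pow_ne_zero _ hx0.ne') (hg x hx j)
  -- at a root of `W(P)` in the window the slopes sum to zero
  have hsum : ∀ x ∈ ({x₁, x₂, x₃} : Set ℝ), ∑ j, rowPsi1 e₁ e₂ (a j 0) (-(a j 1)) (-(a j 2)) x = 0 := by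
    intro x hx
    have hxI := hIoo x hx
    have hx0 : 0 < x := hu.trans hxI.1
    have h := hzero x hx
    rw [logWronskian_prod_eq_rowPsi1_sum d e₁ e₂ he₁ he₂ a hx0 (hf x hxI)] at h
    have hP : ((∏ j, (∑ l, C (a j l) * X ^ (d l) : ℝ[X])).eval x) ≠ 0 := by
      rw [eval_prod]; exact Finset.prod_ne_zero_iff.2 fun j _ => hf x hxI j
    rcases mul_eq_zero.1 h with h1 | h1
    · exact absurd (neg_eq_zero.1 h1) (pow_ne_zero 2 hP)
    · exact h1
  -- kernel rows `S`, cloud rows `T`, roots `ρ`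
  set S : Finset (Fin m) := Finset.univ.filter (fun j => ¬ Pc j) with hS
  set T : Finset (Fin m) := Finset.univ.filter (fun j => Pc j) with hT
  set ρ : Fin m → ℝ := fun j => a j 0 / (-(a j 1)) with hρ
  have hSmem : ∀ j ∈ S, ¬ Pc j := fun j hj => (Finset.mem_filter.1 hj).2
  have hTmem : ∀ j ∈ T, Pc j := fun j hj => (Finset.mem_filter.1 hj).2
  -- the identity `Σ_j ψ₁^{(j)}(x) = p²·y·(Σ_S ρ_j/(y−ρ_j)² + G(y))`, `y = x^p`, at every `x ∈ (u,v)`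
  have hsplit : ∀ x ∈ Ioo u v,
      ∑ j, rowPsi1 e₁ e₂ (a j 0) (-(a j 1)) (-(a j 2)) x
        = ((e₁ : ℝ) + 1) ^ 2 * x ^ (e₁ + 1) *
          (∑ j ∈ S, (1 : ℝ) * ρ j / (x ^ (e₁ + 1) - ρ j) ^ 2
            + ∑ j ∈ T, rowPsi1 e₁ e₂ (a j 0) (-(a j 1)) (-(a j 2)) ((x ^ (e₁ + 1)) ^ (((e₁ + 1 : ℕ) : ℝ)⁻¹))
                / (((e₁ : ℝ) + 1) ^ 2 * x ^ (e₁ + 1))) := by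
    intro x hx
    have hx0 : 0 < x := hu.trans hx.1
    have hxp : 0 < x ^ (e₁ + 1) := pow_pos hx0 _
    rw [Real.pow_rpow_inv_natCast hx0.le (Nat.succ_ne_zero e₁)]
    rw [← Finset.sum_filter_add_sum_filter_not Finset.univ (fun j => Pc j), add_comm, mul_add, Finset.mul_sum, Finset.mul_sum]
    congr 1
    · refine Finset.sum_congr rfl fun j hj => ?_
      obtain ⟨h2, h1, -, -, hne⟩ := hker j (hSmem j hj)
      rw [h2, neg_zero, rowPsi1_binomial_eq e₁ e₂ (a j 0) (-(a j 1)) (neg_ne_zero.2 h1) (hne x hx)]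
      ring
    · refine Finset.sum_congr rfl fun j _ => ?_
      have hp2 : ((e₁ : ℝ) + 1) ^ 2 * x ^ (e₁ + 1) ≠ 0 := mul_ne_zero (by positivity) hxp.ne'
      field_simp
  -- hence the three zeros in `y`
  have hz : ∀ x ∈ ({x₁, x₂, x₃} : Set ℝ),
      ∑ j ∈ S, (1 : ℝ) * ρ j / (x ^ (e₁ + 1) - ρ j) ^ 2
        + (fun y : ℝ => ∑ j ∈ T, rowPsi1 e₁ e₂ (a j 0) (-(a j 1)) (-(a j 2)) (y ^ (((e₁ + 1 : ℕ) : ℝ)⁻¹))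
            / (((e₁ : ℝ) + 1) ^ 2 * y)) (x ^ (e₁ + 1)) = 0 := by
    intro x hx
    have hxI := hIoo x hx
    have hx0 : 0 < x := hu.trans hxI.1
    have h := hsum x hx
    rw [hsplit x hxI] at h
    have hp2 : ((e₁ : ℝ) + 1) ^ 2 * x ^ (e₁ + 1) ≠ 0 := mul_ne_zero (by positivity) (pow_pos hx0 _).ne'
    exact (mul_eq_zero.1 h).resolve_left hp2
  -- the switched puller gives a positive root
  obtain ⟨j₀, hj₀1, hj₀2, hj₀u⟩ := hex
  have hj₀S : j₀ ∈ S := by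
    refine Finset.mem_filter.2 ⟨Finset.mem_univ _, fun hc => ?_⟩
    -- a switched row cannot be unswitched at `v > u`
    have hposv := hcloud j₀ hc
    rw [hev, hj₀2] at hj₀u
    have hsw' : a j₀ 0 + a j₀ 1 * u ^ (e₁ + 1) ≤ 0 := by
      have h := hj₀u
      simp only [zero_mul, add_zero] at h
      rcases (mul_nonpos_iff.1 h) with ⟨_, hle⟩ | ⟨hlt, _⟩
      · exact hle
      · exact absurd (pow_pos hu (d 0)) (not_lt.2 hlt)
    have hlt : a j₀ 1 * x₂ ^ (e₁ + 1) < a j₀ 1 * u ^ (e₁ + 1) :=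
      mul_lt_mul_of_neg_left (pow_lt_pow_left₀ h₂.1 hu.le (Nat.succ_ne_zero e₁)) hj₀1
    have h2 := hposv x₂ h₂
    rw [hj₀2] at h2
    simp only [neg_zero, zero_mul, sub_zero] at h2
    linarith
  have hpos : ∃ j ∈ S, 0 < ρ j := by
    refine ⟨j₀, hj₀S, ?_⟩
    obtain ⟨-, -, h0, -, -⟩ := hker j₀ (hSmem j₀ hj₀S)
    exact div_pos h0 (by linarith)
  -- apply the kernel-plus-convex shell on `(u^p, v^p)`
  have hTF : ∀ i ∈ T, ∀ x ∈ Ioo u v, a i 0 - (-(a i 1)) * x ^ (e₁ + 1) - (-(a i 2)) * x ^ (e₁ + e₂ + 2) ≠ 0 :=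
    fun i hi x hx => (hcloud i (hTmem i hi) x hx).ne'
  refine kernelPlusConvex_inner_no_three_zeros S (fun _ => (1 : ℝ)) ρ (fun _ _ => one_pos) (pow_pos hu (e₁ + 1))
    (fun j hj => (hker j (hSmem j hj)).2.2.2.1) hpos
    (G := fun y : ℝ => ∑ j ∈ T, rowPsi1 e₁ e₂ (a j 0) (-(a j 1)) (-(a j 2)) (y ^ (((e₁ + 1 : ℕ) : ℝ)⁻¹))
      / (((e₁ : ℝ) + 1) ^ 2 * y))
    (G' := fun y : ℝ => ∑ j ∈ T, (rowPsi2 e₁ e₂ (a j 0) (-(a j 1)) (-(a j 2)) (y ^ (((e₁ + 1 : ℕ) : ℝ)⁻¹))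
      - ((e₁ : ℝ) + 1) * rowPsi1 e₁ e₂ (a j 0) (-(a j 1)) (-(a j 2)) (y ^ (((e₁ + 1 : ℕ) : ℝ)⁻¹)))
        / (((e₁ : ℝ) + 1) ^ 3 * y ^ 2))
    (b := v ^ (e₁ + 1)) ?_ ?_ ?_
    (pow_mem_Ioo_pow (e₁ + 1) (Nat.succ_ne_zero e₁) hu h₁) (pow_mem_Ioo_pow (e₁ + 1) (Nat.succ_ne_zero e₁) hu h₃)
    (pow_lt_pow_left₀ h12' (hu.trans h₁.1).le (Nat.succ_ne_zero e₁))
    (pow_lt_pow_left₀ h23 (hu.trans h₂.1).le (Nat.succ_ne_zero e₁))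
    (hz x₁ (by simp)) (hz x₂ (by simp)) (hz x₃ (by simp))
  · -- `HasDerivAt G (G' y) y`
    intro y hy
    obtain ⟨hxy, hy0⟩ := rpow_inv_mem_Ioo e₁ hu huv hy
    exact hasDerivAt_cloudSum T e₁ e₂ (fun j => a j 0) (fun j => -(a j 1)) (fun j => -(a j 2)) hy0
      (fun i hi => hTF i hi _ hxy)
  · -- `0 ≤ G'` from (M)
    intro y hy
    obtain ⟨hxy, hy0⟩ := rpow_inv_mem_Ioo e₁ hu huv hy
    refine cloudSum_deriv_nonneg T e₁ e₂ (fun j => a j 0) (fun j => -(a j 1)) (fun j => -(a j 2)) hy0 (fun i hi => ?_)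
    obtain ⟨_, h1, h2, _, _⟩ := hTmem i hi
    exact rowPsi2_ge e₁ e₂ (a i 0) (-(a i 1)) (-(a i 2)) (hu.trans hxy.1) (by linarith) (by linarith)
      (hcloud i (hTmem i hi) _ hxy)
  · -- `G'` non-decreasing from (Cv)
    refine cloudSum_deriv_monotoneOn T e₁ e₂ (fun j => a j 0) (fun j => -(a j 1)) (fun j => -(a j 2)) hu huv hTF
      (fun i hi x hx => ?_)
    obtain ⟨_, h1, h2, _, _⟩ := hTmem i hi
    exact rowPsi3_convex e₁ e₂ (a i 0) (-(a i 1)) (-(a i 2)) he (hu.trans hx.1) (by linarith) (by linarith)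
      (hcloud i (hTmem i hi) x hx)

/-- ★★ **THE SLOW-KNEE CLOUD CELL** (owner's `SlowKneeCloudCellK3`, spelled out): under the hypotheses of
`slowKneeCloud_wronskian_no_three_zeros`, `W(∏_j f_j) = P·θ(θP) − (θP)²` has AT MOST TWO roots in `(u, v)`. [this file's theorem] -/
theorem slowKneeCloud_wronskian_roots_le_two {m : ℕ} (d : Fin 3 → ℕ) (h01 : d 0 < d 1) (h12 : d 1 < d 2) (hgap : d 1 - d 0 ≤ d 2 - d 1)
    (a : Fin m → Fin 3 → ℝ) {u v : ℝ} (hu : 0 < u)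
    (hrow : ∀ j, (0 < a j 0 ∧ 0 < a j 1 ∧ a j 2 = 0) ∨
      (0 < a j 0 ∧ a j 1 < 0 ∧ a j 2 = 0 ∧ (∑ l, C (a j l) * X ^ (d l) : ℝ[X]).eval u ≤ 0) ∨
      (0 < a j 0 ∧ a j 1 ≤ 0 ∧ a j 2 ≤ 0 ∧ a j 1 + a j 2 < 0 ∧ 0 < (∑ l, C (a j l) * X ^ (d l) : ℝ[X]).eval v))
    (hex : ∃ j, a j 1 < 0 ∧ a j 2 = 0 ∧ (∑ l, C (a j l) * X ^ (d l) : ℝ[X]).eval u ≤ 0) :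
    (((∏ j, ∑ l, C (a j l) * X ^ (d l) : ℝ[X]) * (X * derivative (X * derivative (∏ j, ∑ l, C (a j l) * X ^ (d l) : ℝ[X])))
        - (X * derivative (∏ j, ∑ l, C (a j l) * X ^ (d l) : ℝ[X])) ^ 2).roots.toFinset.filter (fun t => u < t ∧ t < v)).card ≤ 2 := by
  classical
  set W : ℝ[X] := (∏ j, ∑ l, C (a j l) * X ^ (d l) : ℝ[X]) * (X * derivative (X * derivative (∏ j, ∑ l, C (a j l) * X ^ (d l) : ℝ[X])))
      - (X * derivative (∏ j, ∑ l, C (a j l) * X ^ (d l) : ℝ[X])) ^ 2 with hWdef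
  by_contra hgt
  push Not at hgt
  obtain ⟨y₁, hy₁, y₂, hy₂, y₃, hy₃, h12', h23⟩ := exists_three_lt_of_card (T := W.roots.toFinset.filter (fun t => u < t ∧ t < v)) hgt
  by_cases hW0 : W = 0
  · rw [hW0, roots_zero, Multiset.toFinset_zero, Finset.filter_empty] at hy₁; exact absurd hy₁ (Finset.notMem_empty _)
  rw [mem_filter, Multiset.mem_toFinset, mem_roots hW0] at hy₁ hy₂ hy₃
  refine slowKneeCloud_wronskian_no_three_zeros d h01 h12 hgap a hu hrow hex (x₁ := y₁) (x₂ := y₂) (x₃ := y₃)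
    hy₁.2 hy₃.2 h12' h23 ?_
  intro x hx
  simp only [Set.mem_insert_iff, Set.mem_singleton_iff] at hx
  rcases hx with h | h | h <;> subst h
  · exact hy₁.1
  · exact hy₂.1
  · exact hy₃.1

end ProductPlusOne

end Summit.ValiantsHypothesis.ValiantsHypothesis.Theorems.LacunarySymmetroidMatrixDescartes
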